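import Summits.ABC.StewartYu.PadicG3TwoThirdStepR
import Summits.ABC.StewartYu.PadicG3TwoFrameNumericsSharp
import HarnessLib

/-!
# Cell abc-stewartyu, Gen-3 frame at `p = 2` (crux `Y07Two`, stmt-ABC-19659), assembly v2: the pre-scaled
# Fel'dman basis WITH THE COMMON BASE POINT — shape `ShFeldR`, basis step `BasisStepTwoR` at every level, level `0`

`Summits/ABC/StewartYu/PadicG3TwoBasisStepR.lean` — cell `abc-stewartyu` (HOME `run/shared/lean/pub/abc-stewartyu/`),
route `PadicPrimesKummerThird`, seat p5 (g3); v2 of `PadicG3TwoBasisStep.lean` for the base-relative re-indexing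
(`PadicG3TwoThirdReindexR`, `PadicG3TwoThirdStepR`).  One definition (`ShFeldR`) and theorems; no named fact.

THE SHAPE INVARIANT (Nesterenko LNM 1819 §4.3: `λ̄ = 𝐥 − 𝐯_s`).  At level `I` the unknowns `i = (ℓ₀, λ)` of the
ORIGINAL box (`|λⱼ| ≤ Dbox 0 j`, `|λ_θ| ≤ Dθ 0`) carry the `Y₀`-factor `Δ(3^{I*−I}·Y₀; ℓ₀, H)` and exponents
`(uᵢ, u_θᵢ)` with `3^I·uᵢ = λ − c`, `3^I·u_θᵢ = λ_θ − c_θ` for ONE base point `(c, c_θ)` of the box (`ShFeldR`).  Hence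
`|uᵢⱼ| ≤ 2·Dbox 0 j/3^I` — the boxes SHRINK TO `0` — and after the base-relative re-indexing at `i₁` the new base point
is `λ_{i₁}`: `3^{I+1}·uᵢ′ = λᵢ − λ_{i₁}`.  Results: `basisStepTwoR_feld : … → BasisStepTwoR σ (ShFeldR σ I* H L₀) I`
(from the `Y₀`-weight lines of level `I+1` and the box slots `2·Dbox 0 j/3^{I+1} ≤ Dbox (I+1) j`,
`2·Dθ 0/3^{I+1} ≤ Dθ (I+1)`), and level `0`: `siegelTwo_feldRs_of_card` (any shape predicate holding on the box
families with absolute exponents) and `siegelTwo_feldR_of_card` (`ShFeldR`, base point `0`).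

WHAT THIS IS NOT: no numbers; no crux moves.

References: Yu. V. Nesterenko, LNM 1819 (2003), §3.1 Prop 3.1, §4.3 (4.35), (4.45); K. Yu, Acta Math. 211 (2013), (5.1)(i).
-/

noncomputable section

open Finset Polynomial
open Literature.NumberTheory.Transcendental
open Literature.NumberTheory.Transcendental (FeldmanDelta.den)
open Literature.NumberTheory.Transcendental.FeldmanDelta
open Literature.NumberTheory.Transcendental.CW77.Setup (Tau tauNorm)

namespace Summit.ABC.StewartYu

namespace TwoSetup

open Summit.ABC.StewartYu.FeldmanBasis Summit.ABC.StewartYu.G3Boxes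

variable {S : TwoSetup} (σ : S.G3TwoSched)

/-- **The shape predicate with the common base point** (pre-scaled Fel'dman basis, original box, base-relative
exponents): at level `I`, `Rᵢ = Δ(3^{I*−I}·Y₀; i.1, H)`, `i.1 ≤ L₀`, `i.2` in the level-`0` box, and
`3^I·(uᵢ, u_θᵢ) = i.2 − (c, c_θ)` for one base point `(c, c_θ)` of the box. [cite: Nesterenko2003, §4.3 (4.35); shape only] -/
def ShFeldR (Istar H L₀ : ℕ) (I : ℕ) (Λ : S.G3Fam (ℕ × ((Fin S.d → ℤ) × ℤ))) : Prop :=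
  (∀ i ∈ Λ.B, i.1 ≤ L₀ ∧ Λ.R i = feldRs i.1 H (Istar - I) ∧
    (∀ j, |i.2.1 j| ≤ (σ.Dbox 0 j : ℤ)) ∧ |i.2.2| ≤ (σ.Dθ 0 : ℤ)) ∧
  ∃ (c : Fin S.d → ℤ) (cθ : ℤ), (∀ j, |c j| ≤ (σ.Dbox 0 j : ℤ)) ∧ |cθ| ≤ (σ.Dθ 0 : ℤ) ∧
    ∀ i ∈ Λ.B, (∀ j, 3 ^ I * Λ.u i j = i.2.1 j - c j) ∧ 3 ^ I * Λ.uθ i = i.2.2 - cθ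

/-- From `3^e·u = a − b` with `|a|, |b| ≤ D`: `|u| ≤ 2D/3^e`. [folklore] -/
theorem abs_le_two_mul_div_of_pow_mul_eq {e : ℕ} {u a b D : ℤ} (h : 3 ^ e * u = a - b) (ha : |a| ≤ D)
    (hb : |b| ≤ D) : |u| ≤ 2 * D / 3 ^ e := by
  have hpos : (0 : ℤ) < 3 ^ e := by positivity
  rw [Int.le_ediv_iff_mul_le hpos]
  have h1 : |u| * 3 ^ e = |a - b| := by
    rw [← h, abs_mul, abs_of_pos hpos, mul_comm]
  rw [h1]
  calc |a - b| ≤ |a| + |b| := abs_sub _ _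
    _ ≤ 2 * D := by omega

/-- **THE BASIS STEP (v2) for the pre-scaled Fel'dman basis with base point**, at a level `I` with `I + 1 ≤ I*`:
from the `Y₀`-weight lines of level `I + 1` and the box slots `2·Dbox 0 j/3^{I+1} ≤ Dbox (I+1) j`,
`2·Dθ 0/3^{I+1} ≤ Dθ (I+1)`. [cite: Nesterenko2003, §3.1 Prop 3.1 and §4.3 (4.35), (4.45)] -/
theorem basisStepTwoR_feld {H L₀ I : ℕ} (hH : 1 ≤ H) (hI : I + 1 ≤ σ.Istar)
    (hden₀ : ∀ (x : ℤ) (τ : Tau S.d), σ.den₀ (I + 1) x τ = Nat.lcmUpto H ^ τ.1)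
    (hM₀ : ∀ (x : ℤ) (τ : Tau S.d), ∀ ℓ, ℓ ≤ L₀ →
      (3 : ℝ) ^ ((σ.Istar - (I + 1)) * τ.1) * ((Nat.lcmUpto H : ℝ) ^ τ.1 *
        (Real.exp (H / Real.exp 1) *
          (Real.exp 1 * (1 + (3 : ℝ) ^ (σ.Istar - (I + 1)) * |(x : ℝ)| / H)) ^ ℓ)) ≤ σ.M₀ (I + 1) x τ)
    (hDbox : ∀ j, 2 * (σ.Dbox 0 j : ℤ) / 3 ^ (I + 1) ≤ (σ.Dbox (I + 1) j : ℤ))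
    (hDθ : 2 * (σ.Dθ 0 : ℤ) / 3 ^ (I + 1) ≤ (σ.Dθ (I + 1) : ℤ)) :
    BasisStepTwoR σ (ShFeldR σ σ.Istar H L₀) I := by
  have hcomp : ∀ ℓ, (feldRs ℓ H (σ.Istar - I)).comp (C (3⁻¹ : ℚ) * X) = feldRs ℓ H (σ.Istar - (I + 1)) := by
    intro ℓ
    have e : σ.Istar - I = (σ.Istar - (I + 1)) + 1 := by omega
    rw [e, feldRs_succ_comp_third]
  -- the new exponents times `3^{I+1}` are differences of original points
  have hdiff : ∀ Λ : S.G3Fam (ℕ × ((Fin S.d → ℤ) × ℤ)), S.G3Adm σ (ShFeldR σ σ.Istar H L₀) I Λ →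
      ∀ i₁ ∈ Λ.B, ∀ i ∈ (Λ.reindex3R i₁).B,
        (∀ j, 3 ^ (I + 1) * (Λ.reindex3R i₁).u i j = i.2.1 j - i₁.2.1 j) ∧
          3 ^ (I + 1) * (Λ.reindex3R i₁).uθ i = i.2.2 - i₁.2.2 := by
    intro Λ hadm i₁ hi₁ i hi
    obtain ⟨_, c, cθ, _, _, hbase⟩ := hadm.shape
    have hiB : i ∈ Λ.B := Λ.reindex3R_B_subset i₁ hi
    refine ⟨fun j => ?_, ?_⟩
    · have h3 := Λ.u_eq_of_memR i₁ hi j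
      have e1 := (hbase i hiB).1 j
      have e2 := (hbase i₁ hi₁).1 j
      rw [pow_succ]
      linear_combination e1 - e2 - 3 ^ I * h3
    · have h3 := Λ.uθ_eq_of_memR i₁ hi
      have e1 := (hbase i hiB).2
      have e2 := (hbase i₁ hi₁).2
      rw [pow_succ]
      linear_combination e1 - e2 - 3 ^ I * h3
  refine ⟨?_, ?_, ?_⟩
  · intro Λ hadm i hi x τ
    obtain ⟨hℓ, hR, _, _⟩ := hadm.shape.1 i hi
    rw [hR, hcomp, hden₀]
    exact exists_int_lcm_pow_mul_hasse_feldRs i.1 hH _ τ.1 x (hM₀ x τ i.1 hℓ)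
  · intro Λ hadm i₁ hi₁ i hi
    have hiB : i ∈ Λ.B := Λ.reindex3R_B_subset i₁ hi
    obtain ⟨_, _, hbi, hbiθ⟩ := hadm.shape.1 i hiB
    obtain ⟨_, _, hb1, hb1θ⟩ := hadm.shape.1 i₁ hi₁
    have hd := hdiff Λ hadm i₁ hi₁ i hi
    refine ⟨fun j => ?_, ?_⟩
    · exact (abs_le_two_mul_div_of_pow_mul_eq (hd.1 j) (hbi j) (hb1 j)).trans (hDbox j)
    · exact (abs_le_two_mul_div_of_pow_mul_eq hd.2 hbiθ hb1θ).trans hDθ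
  · intro Λ hadm i₁ hi₁
    obtain ⟨hsh, c, cθ, _, _, _⟩ := hadm.shape
    obtain ⟨_, _, hb1, hb1θ⟩ := hsh i₁ hi₁
    refine ⟨fun i hi => ?_, i₁.2.1, i₁.2.2, hb1, hb1θ, fun i hi => hdiff Λ hadm i₁ hi₁ i hi⟩
    have hiB : i ∈ Λ.B := Λ.reindex3R_B_subset i₁ hi
    obtain ⟨hℓ, hR, hbi, hbiθ⟩ := hsh i hiB
    refine ⟨hℓ, ?_, hbi, hbiθ⟩
    change (Λ.R i).comp (C (3⁻¹ : ℚ) * X) = _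
    rw [hR, hcomp]

/-! ### Level `0` for an arbitrary shape predicate on the box families -/

/-- **LEVEL `0` FOR THE PRE-SCALED FEL'DMAN BASIS, any shape predicate** holding on the sub-box families with
absolute exponents (hypothesis `hSh`), from the card inequality `2·2^m·#E₀ ≤ #box`. [cite: Yu2013, Lemma 4.2 and (5.22)] -/
theorem siegelTwo_feldRs_of_card (Sh : ℕ → S.G3Fam (ℕ × ((Fin S.d → ℤ) × ℤ)) → Prop) (H L₀ : ℕ) (hH : 1 ≤ H)
    (hΛ : ‖S.Λ₀‖ ≤ ((2 : ℝ) ^ (σ.m + 3))⁻¹)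
    (hT0 : 1 ≤ σ.T0 0)
    (hE : 2 * 2 ^ σ.m * (eqSet S.d (σ.N0 0) (σ.T0 0)).card ≤ (famBox L₀ (σ.Dbox 0) (σ.Dθ 0)).card)
    (hcardB : (famBox L₀ (σ.Dbox 0) (σ.Dθ 0)).card ≤ σ.cardB 0)
    (hL : L₀ ≤ σ.D₀)
    (hXb : ∀ i ∈ famBox L₀ (σ.Dbox 0) (σ.Dθ 0), ∀ j, |S.dirScalar i.2.1 i.2.2 j| ≤ σ.Xb 0)
    (hBw : ∀ ℓ, ℓ ≤ L₀ → ‖((den ℓ H : ℚ_[2]))⁻¹‖ * (4 * (2 : ℝ) ^ σ.m) ^ ℓ ≤ σ.Bw 0)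
    (hden₀ : ∀ (x : ℤ) (τ : Tau S.d), σ.den₀ 0 x τ = Nat.lcmUpto H ^ τ.1)
    (hM₀ : ∀ (x : ℤ) (τ : Tau S.d), ∀ ℓ, ℓ ≤ L₀ →
      (3 : ℝ) ^ (σ.Istar * τ.1) * ((Nat.lcmUpto H : ℝ) ^ τ.1 *
        (Real.exp (H / Real.exp 1) * (Real.exp 1 * (1 + (3 : ℝ) ^ σ.Istar * |(x : ℝ)| / H)) ^ ℓ)) ≤
        σ.M₀ 0 x τ)
    {M₀E : ℤ} (hM₀E : ∀ e ∈ eqSet S.d (σ.N0 0) (σ.T0 0), σ.M₀ 0 e.1 e.2 ≤ M₀E)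
    {Amax : ℝ} (hAmax : 1 ≤ Amax)
    (hA : ∀ e ∈ eqSet S.d (σ.N0 0) (σ.T0 0), (M₀E : ℝ) * (σ.Xb 0 : ℝ) ^ (∑ j, e.2.2 j) *
      ((MonomialDen.monDen S.toQ.all (S.boxExp (σ.Dbox 0) (σ.Dθ 0) e.1) : ℝ)) ^ 2 ≤ Amax)
    (hP : ⌈((famBox L₀ (σ.Dbox 0) (σ.Dθ 0)).card : ℝ) * Amax⌉ ≤ σ.P)
    (hSh : ∀ (B' : Finset (ℕ × ((Fin S.d → ℤ) × ℤ))) (p : ℕ × ((Fin S.d → ℤ) × ℤ) → ℤ)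
      (i₀ : ℕ × ((Fin S.d → ℤ) × ℤ)), B' ⊆ famBox L₀ (σ.Dbox 0) (σ.Dθ 0) → i₀ ∈ B' →
      Sh 0 ⟨B', fun i => feldRs i.1 H σ.Istar, fun i => i.2.1, fun i => i.2.2, p, i₀⟩) :
    SiegelTwo σ Sh := by
  classical
  set B : Finset (ℕ × ((Fin S.d → ℤ) × ℤ)) := famBox L₀ (σ.Dbox 0) (σ.Dθ 0) with hBdef
  set E : Finset (ℤ × Tau S.d) := eqSet S.d (σ.N0 0) (σ.T0 0) with hEdef
  set R : ℕ × ((Fin S.d → ℤ) × ℤ) → ℚ[X] := fun i => feldRs i.1 H σ.Istar with hRdef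
  set u : ℕ × ((Fin S.d → ℤ) × ℤ) → Fin S.d → ℤ := fun i => i.2.1 with hudef
  set uθ : ℕ × ((Fin S.d → ℤ) × ℤ) → ℤ := fun i => i.2.2 with huθdef
  have hbox := S.feldman_box_le B (subset_refl _)
  have hlcm1 : 1 ≤ Nat.lcmUpto H := Nat.lcmUpto_pos H
  have hden₀1 : ∀ e ∈ E, 1 ≤ σ.den₀ 0 e.1 e.2 := by
    intro e _; rw [hden₀]; exact Nat.one_le_pow _ _ hlcm1
  have hhasse : ∀ i ∈ B, ∀ (x : ℤ) (τ : Tau S.d), ∃ z₀ : ℤ,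
      (σ.den₀ 0 x τ : ℚ) * (hasseDeriv τ.1 (R i)).eval (x : ℚ) = z₀ ∧ |z₀| ≤ σ.M₀ 0 x τ := by
    intro i hi x τ
    rw [hden₀]
    have h := exists_int_lcm_pow_mul_hasse_feldRs i.1 hH σ.Istar τ.1 x
      (hM₀ x τ i.1 (mem_famBox.mp hi).1)
    simpa only [hRdef] using h
  have hR : ∀ e ∈ E, ∀ i ∈ B, ∃ z₀ : ℤ,
      ((σ.den₀ 0 e.1 e.2 : ℕ) : ℚ) * (hasseDeriv e.2.1 (R i)).eval (e.1 : ℚ) = z₀ ∧ |z₀| ≤ M₀E := by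
    intro e he i hi
    obtain ⟨z₀, hz₀, hle⟩ := hhasse i hi e.1 e.2
    exact ⟨z₀, hz₀, hle.trans (hM₀E e he)⟩
  obtain ⟨𝔏, p, h𝔏B, _hcnt, _h𝔏ne, hslab, hsupp, ⟨i₀, hpi₀⟩, hpbd, hsol⟩ :=
    S.exists_g3_slab_siegel R u uθ B σ.m hΛ E (eqSet_nonempty S.d (σ.N0 0) hT0) hE hbox.1 hbox.2
      (fun e => σ.den₀ 0 e.1 e.2) hden₀1 hR hXb hAmax hA
  have hi₀ : i₀ ∈ 𝔏 := hsupp i₀ hpi₀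
  have h𝔏card : 𝔏.card ≤ B.card := card_le_card h𝔏B
  have hdegs := S.feldRs_degrees H σ.Istar hL 𝔏 h𝔏B
  have hρ1 : (1 : ℝ) ≤ 4 * (2 : ℝ) ^ σ.m := by
    have : (1 : ℝ) ≤ 2 ^ σ.m := one_le_pow₀ (by norm_num)
    nlinarith
  refine ⟨⟨𝔏, R, u, uθ, p, i₀⟩, ?_, ?_⟩
  · exact
      { card_le := h𝔏card.trans hcardB
        exists_ne := ⟨i₀, hi₀, hpi₀⟩
        deg_ne := hdegs.1
        R_ne := hdegs.2.1
        deg_le := hdegs.2.2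
        p_le := by
          intro i _
          refine (hpbd i).trans (le_trans ?_ hP)
          exact Int.ceil_le_ceil (mul_le_mul_of_nonneg_right (by exact_mod_cast h𝔏card)
            (le_trans zero_le_one hAmax))
        u_le := (S.feldman_box_le 𝔏 h𝔏B).1
        uθ_le := (S.feldman_box_le 𝔏 h𝔏B).2
        dir_le := fun i hi j => hXb i (h𝔏B hi) j
        slab := hslab i₀ hi₀
        wt := fun i hi t₀ k =>
          (norm_coeff_hw_feldRs_mul_pow_le (fun i : ℕ × ((Fin S.d → ℤ) × ℤ) => i.1) H σ.Istar i t₀ k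
            hρ1).trans (hBw i.1 (mem_famBox.mp (h𝔏B hi)).1)
        hasse := fun i hi x τ => hhasse i (h𝔏B hi) x τ
        shape := hSh 𝔏 p i₀ h𝔏B hi₀ }
  · rw [G3Fam.vanish_all_iff]
    exact vanish_of_eqSet S R u uθ 𝔏 p hsol

/-- **LEVEL `0` WITH THE BASE-POINT SHAPE `ShFeldR`** (base point `0`). [cite: Yu2013, Lemma 4.2 and (5.22)] -/
theorem siegelTwo_feldR_of_card (H L₀ : ℕ) (hH : 1 ≤ H)
    (hΛ : ‖S.Λ₀‖ ≤ ((2 : ℝ) ^ (σ.m + 3))⁻¹)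
    (hT0 : 1 ≤ σ.T0 0)
    (hE : 2 * 2 ^ σ.m * (eqSet S.d (σ.N0 0) (σ.T0 0)).card ≤ (famBox L₀ (σ.Dbox 0) (σ.Dθ 0)).card)
    (hcardB : (famBox L₀ (σ.Dbox 0) (σ.Dθ 0)).card ≤ σ.cardB 0)
    (hL : L₀ ≤ σ.D₀)
    (hXb : ∀ i ∈ famBox L₀ (σ.Dbox 0) (σ.Dθ 0), ∀ j, |S.dirScalar i.2.1 i.2.2 j| ≤ σ.Xb 0)
    (hBw : ∀ ℓ, ℓ ≤ L₀ → ‖((den ℓ H : ℚ_[2]))⁻¹‖ * (4 * (2 : ℝ) ^ σ.m) ^ ℓ ≤ σ.Bw 0)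
    (hden₀ : ∀ (x : ℤ) (τ : Tau S.d), σ.den₀ 0 x τ = Nat.lcmUpto H ^ τ.1)
    (hM₀ : ∀ (x : ℤ) (τ : Tau S.d), ∀ ℓ, ℓ ≤ L₀ →
      (3 : ℝ) ^ (σ.Istar * τ.1) * ((Nat.lcmUpto H : ℝ) ^ τ.1 *
        (Real.exp (H / Real.exp 1) * (Real.exp 1 * (1 + (3 : ℝ) ^ σ.Istar * |(x : ℝ)| / H)) ^ ℓ)) ≤
        σ.M₀ 0 x τ)
    {M₀E : ℤ} (hM₀E : ∀ e ∈ eqSet S.d (σ.N0 0) (σ.T0 0), σ.M₀ 0 e.1 e.2 ≤ M₀E)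
    {Amax : ℝ} (hAmax : 1 ≤ Amax)
    (hA : ∀ e ∈ eqSet S.d (σ.N0 0) (σ.T0 0), (M₀E : ℝ) * (σ.Xb 0 : ℝ) ^ (∑ j, e.2.2 j) *
      ((MonomialDen.monDen S.toQ.all (S.boxExp (σ.Dbox 0) (σ.Dθ 0) e.1) : ℝ)) ^ 2 ≤ Amax)
    (hP : ⌈((famBox L₀ (σ.Dbox 0) (σ.Dθ 0)).card : ℝ) * Amax⌉ ≤ σ.P) :
    SiegelTwo σ (ShFeldR σ σ.Istar H L₀) := by
  refine siegelTwo_feldRs_of_card σ _ H L₀ hH hΛ hT0 hE hcardB hL hXb hBw hden₀ hM₀ hM₀E hAmax hA hP ?_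
  intro B' p i₀ hB' _
  refine ⟨fun i hi => ?_, fun _ => 0, 0, fun _ => by simp, by simp, fun i _ => ⟨fun j => by simp, by simp⟩⟩
  have hm := mem_famBox.mp (hB' hi)
  exact ⟨hm.1, by rw [Nat.sub_zero], hm.2.1, hm.2.2⟩

end TwoSetup

end Summit.ABC.StewartYu

end
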